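import Mathlib
import Literature.Probability.LatticeModels.ProdBernoulliIndependence
import Literature.Probability.Percolation.PercolationProofs
import HarnessLib

/-!
# Crux `PercNearOneGluing.NearOneGluing` (stmt-CriticalPhenomena-4574) — deliverable:
# the TWO-SENTINEL bound (Kozma–Nitzan Conjecture 3 in linear, `|A|`-free form under non-interleaving;
# the planar case "`o` and `A` on one face")

Lead prover-line-stmt-CriticalPhenomena-4574-c1-0 (line `SketchR2I5`), 2026-08-16; the lever is idea card
`Cruxes/NearOneGluing/Ideas/sentinel-duality.md` §(1) (crux-ideate r1, ideator 1), whose typed sketch never reached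
the tree.  Lands with `--supports stmt-CriticalPhenomena-4574`.

Setting: `μ = prodBernoulli w` on bond configurations `ω : Set (Sym2 (Fin n))`; relays `A`, source `o`, target `b`.

## Result (`twoSentinel_bound`, `twoSentinel_gluing`)

Let `r : Fin n → ℕ` be injective on `insert o A` with `r o < r a` for all `a ∈ A` (a "boundary order" starting at
`o`), and suppose the configuration space satisfies NON-INTERLEAVING along `r` almost surely — here: for all `ω` and all
`x y z u ∈ insert o A` with `r x < r y < r z < r u`, if `x ↔ z` and `y ↔ u` then `x ↔ y` (two open clusters whose
traces on the ordered set interleave coincide).  This holds for every PLANAR weighted graph in which `o` and all of `A`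
lie on one face, listed in the cyclic order of that face starting at `o` (two vertex-disjoint paths inside a disc with
interleaved endpoints on its boundary must meet — the discrete Jordan curve theorem; not formalised here, the theorem
takes non-interleaving as its hypothesis).  Let `a₁`, `a₂ ∈ A` be the relays of minimal and maximal rank (the two
SENTINELS: the cyclic neighbours of `o` among `A`).  Then pointwise
`{o ↮ b} ⊆ {o ↮ A} ∪ {a₁ ↮ b} ∪ {a₂ ↮ b}`, hence
`μ(o ↮ b) ≤ μ(o ↮ A) + μ(a₁ ↮ b) + μ(a₂ ↮ b) ≤ μ(o ↮ A) + 2·max_a μ(a ↮ b)`: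
Conjecture 3 (indeed the additive form of Conjecture 1 with constant 2) holds uniformly in `|A|` on this class.
Proof of the inclusion: if `o ↮ b` and `o ↔ a`, `a ∈ A`, then either `a` is a sentinel (and is dead with `o`), or
`r o < r a₁ < r a < r a₂`; were both sentinels joined to `b` they would be joined to each other, and non-interleaving
(`x = o`, `y = a₁`, `z = a`, `u = a₂`) would join `o` to `a₁`, hence to `b`.

Moral for the crux (recorded in the card and in Lines/SketchR2I5.md): when the footprints `C(o) ∩ A` are forced to
be order-intervals the whole difficulty evaporates; a counterexample family is necessarily non-planar around `o`
(spread, crossing footprints).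
-/

namespace Summit.CriticalPhenomena.PercolationContinuityZ3.Theorems

open scoped BigOperators Classical
open MeasureTheory Set
open Literature.Probability.LatticeModels (prodBernoulli)
open Literature.Probability.Percolation

variable {n : ℕ}

/-- **Two-sentinel inclusion (pointwise).** Under non-interleaving along a boundary order `r` starting at `o`,
with sentinels `a₁` (minimal rank in `A`) and `a₂` (maximal rank in `A`):
`{o ↮ b} ⊆ {o ↮ A} ∪ {a₁ ↮ b} ∪ {a₂ ↮ b}`. -/
theorem twoSentinel_subset (A : Finset (Fin n)) (o b a₁ a₂ : Fin n) (r : Fin n → ℕ)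
    (hr : Set.InjOn r ↑(insert o A)) (hro : ∀ a ∈ A, r o < r a)
    (ha₁ : a₁ ∈ A) (ha₂ : a₂ ∈ A) (hmin : ∀ a ∈ A, r a₁ ≤ r a) (hmax : ∀ a ∈ A, r a ≤ r a₂)
    (hNI : ∀ (ω : Set (Sym2 (Fin n))) (x y z u : Fin n), x ∈ insert o A → y ∈ insert o A →
      z ∈ insert o A → u ∈ insert o A → r x < r y → r y < r z → r z < r u →
      ω ∈ openConn x z → ω ∈ openConn y u → ω ∈ openConn x y) :
    (openConn o b)ᶜ ⊆ (⋃ a ∈ A, openConn o a)ᶜ ∪ ((openConn a₁ b)ᶜ ∪ (openConn a₂ b)ᶜ) := by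
  intro ω hob
  by_cases hA : ω ∈ ⋃ a ∈ A, openConn o a
  · right
    simp only [Set.mem_iUnion, exists_prop] at hA
    obtain ⟨a, haA, hoa⟩ := hA
    -- `o ↔ a`; if both sentinels reach `b`, derive `o ↔ b`
    by_contra hboth
    simp only [Set.mem_union, Set.mem_compl_iff, not_or, not_not] at hboth
    obtain ⟨h1b, h2b⟩ := hboth
    have hoa' : (openGraph ω).Reachable o a := hoa
    have h1b' : (openGraph ω).Reachable a₁ b := h1b
    have h2b' : (openGraph ω).Reachable a₂ b := h2b
    apply hob
    show (openGraph ω).Reachable o b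
    by_cases h1 : a = a₁
    · subst h1; exact hoa'.trans h1b'
    by_cases h2 : a = a₂
    · subst h2; exact hoa'.trans h2b'
    -- strict order `r o < r a₁ < r a < r a₂`
    have hmemo : o ∈ (↑(insert o A) : Set (Fin n)) := by simp
    have hmem : ∀ x ∈ A, x ∈ (↑(insert o A) : Set (Fin n)) := fun x hx => by simp [hx]
    have hlt1 : r a₁ < r a := lt_of_le_of_ne (hmin a haA) fun h => h1 (hr (hmem a haA) (hmem a₁ ha₁) h.symm)
    have hlt2 : r a < r a₂ := lt_of_le_of_ne (hmax a haA) fun h => h2 (hr (hmem a haA) (hmem a₂ ha₂) h)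
    have h12 : ω ∈ openConn a₁ a₂ := show (openGraph ω).Reachable a₁ a₂ from h1b'.trans h2b'.symm
    have key := hNI ω o a₁ a a₂ (Finset.mem_insert_self o A) (Finset.mem_insert_of_mem ha₁)
      (Finset.mem_insert_of_mem haA) (Finset.mem_insert_of_mem ha₂) (hro a₁ ha₁) hlt1 hlt2 hoa h12
    have key' : (openGraph ω).Reachable o a₁ := key
    exact key'.trans h1b'
  · left; exact hA

/-- **Two-sentinel bound (`|A|`-free, linear).** Under non-interleaving along a boundary order starting at `o`
(e.g. a planar weighted graph with `o` and all of `A` on one face), with sentinels `a₁`, `a₂` the relays of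
minimal / maximal rank: `μ(o ↮ b) ≤ μ(o ↮ A) + μ(a₁ ↮ b) + μ(a₂ ↮ b)`. -/
theorem twoSentinel_bound (w : Sym2 (Fin n) → unitInterval) (A : Finset (Fin n)) (o b a₁ a₂ : Fin n)
    (r : Fin n → ℕ) (hr : Set.InjOn r ↑(insert o A)) (hro : ∀ a ∈ A, r o < r a)
    (ha₁ : a₁ ∈ A) (ha₂ : a₂ ∈ A) (hmin : ∀ a ∈ A, r a₁ ≤ r a) (hmax : ∀ a ∈ A, r a ≤ r a₂)
    (hNI : ∀ (ω : Set (Sym2 (Fin n))) (x y z u : Fin n), x ∈ insert o A → y ∈ insert o A →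
      z ∈ insert o A → u ∈ insert o A → r x < r y → r y < r z → r z < r u →
      ω ∈ openConn x z → ω ∈ openConn y u → ω ∈ openConn x y) :
    (prodBernoulli w).real (openConn o b)ᶜ ≤
      (prodBernoulli w).real (⋃ a ∈ A, openConn o a)ᶜ +
        ((prodBernoulli w).real (openConn a₁ b)ᶜ + (prodBernoulli w).real (openConn a₂ b)ᶜ) := by
  have hsub := twoSentinel_subset A o b a₁ a₂ r hr hro ha₁ ha₂ hmin hmax hNI
  calc (prodBernoulli w).real (openConn o b)ᶜ
      ≤ (prodBernoulli w).real ((⋃ a ∈ A, openConn o a)ᶜ ∪ ((openConn a₁ b)ᶜ ∪ (openConn a₂ b)ᶜ)) :=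
        measureReal_mono hsub (measure_ne_top _ _)
    _ ≤ (prodBernoulli w).real (⋃ a ∈ A, openConn o a)ᶜ +
          (prodBernoulli w).real ((openConn a₁ b)ᶜ ∪ (openConn a₂ b)ᶜ) := measureReal_union_le _ _
    _ ≤ (prodBernoulli w).real (⋃ a ∈ A, openConn o a)ᶜ +
          ((prodBernoulli w).real (openConn a₁ b)ᶜ + (prodBernoulli w).real (openConn a₂ b)ᶜ) := by
        have := measureReal_union_le (μ := prodBernoulli w) (openConn a₁ b)ᶜ (openConn a₂ b)ᶜ
        linarith

/-- **Kozma–Nitzan Conjecture 3 on the non-interleaved class, in additive form with constant 2.**  If `r` is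
injective on `insert o A` with `o` of minimal rank, non-interleaving along `r` holds for every configuration, `A`
is nonempty and `μ(a ↮ b) ≤ t` for every `a ∈ A`, then `μ(o ↮ b) ≤ μ(o ↮ A) + 2t` — uniformly in `|A|`.
(For `A = ∅` the hypothesis `μ(o ↮ A)` small is never met, and the crux is vacuous there.) -/
theorem twoSentinel_gluing : ∀ (n : ℕ) (w : Sym2 (Fin n) → unitInterval) (A : Finset (Fin n)) (o b : Fin n), A.Nonempty → ∀ (r : Fin n → ℕ), Set.InjOn r ↑(insert o A) → (∀ a ∈ A, r o < r a) → (∀ (ω : Set (Sym2 (Fin n))) (x y z u : Fin n), x ∈ insert o A → y ∈ insert o A → z ∈ insert o A → u ∈ insert o A → r x < r y → r y < r z → r z < r u → ω ∈ Literature.Probability.Percolation.openConn x z → ω ∈ Literature.Probability.Percolation.openConn y u → ω ∈ Literature.Probability.Percolation.openConn x y) → ∀ (t : ℝ), (∀ a ∈ A, (Literature.Probability.LatticeModels.prodBernoulli w).real (Literature.Probability.Percolation.openConn a b)ᶜ ≤ t) → (Literature.Probability.LatticeModels.prodBernoulli w).real (Literature.Probability.Percolation.openConn o b)ᶜ ≤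 (Literature.Probability.LatticeModels.prodBernoulli w).real (⋃ a ∈ A, Literature.Probability.Percolation.openConn o a)ᶜ + 2 * t := by
  intro n w A o b hA r hr hro hNI t hrel
  obtain ⟨a₁, ha₁, hmin⟩ := A.exists_min_image r hA
  obtain ⟨a₂, ha₂, hmax⟩ := A.exists_max_image r hA
  have h := twoSentinel_bound w A o b a₁ a₂ r hr hro ha₁ ha₂ hmin hmax hNI
  have h1 := hrel a₁ ha₁
  have h2 := hrel a₂ ha₂
  linarith

end Summit.CriticalPhenomena.PercolationContinuityZ3.Theorems
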